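import Mathlib
import HarnessLib
import Summits.ValiantsHypothesis.ValiantsHypothesis.Theorems.MonotoneRestorationOrbitRestorationQPColumnGrouped
import Summits.ValiantsHypothesis.ValiantsHypothesis.Theorems.MonotoneRestorationOrbitRestorationQPBlockTransport
import Summits.ValiantsHypothesis.ValiantsHypothesis.Theorems.MonotoneRestorationOrbitRestorationQPLocalFormShape

/-!
# Matrix-symmetric affine products with column-untwisted groupings are narrow (SPAN currency, no block-untwistedness)

Route MonotoneRestoration, crux `OrbitRestorationQP` (stmt-ValiantsHypothesis-18293), SPAN-currency lane of the open
sub-rung A_∞ (`stub_sigmaPiSigmaValue`), `ΠΣ` part; residue R3 of `BLOCK-LANE-g7g5.md` (square roots of the sign-twisted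
support blocks).  Helper (`--supports`), def-free.

Let `f = C a · Π_i L_i ≠ 0` (degree-one factors) be invariant under all row and all column renamings, and let `S` be a
column-support labelling of the factors (scalar-invariant, column-equivariant, row-invariant, `|S(L_i)| ≤ c₀`,
`2c₀ < n`, and `L_i` fixed by the column renamings fixing `S(L_i)` pointwise — as delivered by
`LocalFactors.exists_rowColSupports_of_matrixSymmetric` with `c₀ = k − 1`).  Group the factors by column label:
`G_T = Π_{i : S(L_i) = T} L_i`.

* `exists_evalRowAtoms_of_colFixed` — a polynomial of total degree `≤ 1` fixed by the column renamings fixing the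
  (injectively placed) core `ψ` pointwise is a polynomial in the row atoms `x_{a, ψ b}`, `R_a`
  (`LocalFormShape.eq_localForm_of_rowCol_invariant` with all rows);
* **`prod_mem_narrowSpan_of_colUntwisted_matrixSymmetric_supports`** — if the groupings are COLUMN-UNTWISTED
  (`τ · G_T = c · G_T ⇒ c = 1`), then `f ∈ span_ℂ {hom_{F,n} : tw F ≤ 2c₀ + 1}`.  Row sign twists of any kind are
  allowed: they are killed by the pairing theorem (`SuperAtoms.prod_mem_narrowSpan_of_colGrouped`).  This strictly
  contains the block-untwisted theorem `NormalisedFactors.prod_mem_narrowSpan_of_supportBlockUntwisted` restricted to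
  such labellings and covers the column Vandermondes `W_n` and their generalisations.

Remaining for span-A₁: the mirror statement (row-untwisted groupings, by transposition) is formal; the genuine residue
is the DOUBLY TWISTED type (some column grouping column-twisted AND some row grouping row-twisted).  No registered stub
is closed; the crux and VP ≠ VNP are not moved. [folklore; cite: DwivediPagoSeppelt2026, §8]
-/

noncomputable section

open scoped Pointwise

-- `Summit.ValiantsHypothesis.ValiantsHypothesis.…` is the tree's single-conjunct layout (Sub = Summit).
set_option linter.dupNamespace false

namespace Summit.ValiantsHypothesis.ValiantsHypothesis.Theorems

namespace SuperAtoms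

open MvPolynomial Finset Equiv ProductAction
open Literature.Computability.AlgebraicComplexity (homPoly)
open Literature.Combinatorics.SimpleGraph (treewidth)

variable {n : ℕ}

/-! ### Degree-one forms fixed off a column core are row-atom polynomials -/

/-- **A form of total degree `≤ 1` fixed by the column renamings fixing the placed core `ψ` pointwise is a polynomial
in the row atoms `x_{a, ψ b}`, `R_a`.** [folklore] -/
theorem exists_evalRowAtoms_of_colFixed (c : ℕ) (ψ : Fin c → Fin n) (hψ : Function.Injective ψ)
    (ℓ : MvPolynomial (Fin n × Fin n) ℂ) (hdeg : ℓ.totalDegree ≤ 1)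
    (hfix : ∀ ρ : Perm (Fin n), (∀ b, ρ (ψ b) = ψ b) → rename (fun P : Fin n × Fin n => (P.1, ρ P.2)) ℓ = ℓ) :
    ∃ P : MvPolynomial (Fin n × (Fin c ⊕ Unit)) ℂ,
      ℓ = aeval (fun w : Fin n × (Fin c ⊕ Unit) =>
        Sum.elim (fun b : Fin c => (X (w.1, ψ b) : MvPolynomial (Fin n × Fin n) ℂ))
          (fun _ : Unit => ∑ j : Fin n, (X (w.1, j) : MvPolynomial (Fin n × Fin n) ℂ)) w.2) P := by
  classical
  set T : Finset (Fin n) := (univ : Finset (Fin c)).image ψ with hT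
  have hrow' : ∀ ρ : Perm (Fin n), (∀ x ∈ (univ : Finset (Fin n)), ρ x = x) →
      rename (fun P : Fin n × Fin n => (ρ P.1, P.2)) ℓ = ℓ := by
    intro ρ hρ
    have : (fun P : Fin n × Fin n => (ρ P.1, P.2)) = id := funext fun P => Prod.ext (hρ P.1 (mem_univ _)) rfl
    rw [this, rename_id, AlgHom.id_apply]
  have hcol' : ∀ ρ : Perm (Fin n), (∀ x ∈ T, ρ x = x) → rename (fun P : Fin n × Fin n => (P.1, ρ P.2)) ℓ = ℓ := by
    intro ρ hρ
    refine hfix ρ fun b => hρ _ ?_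
    rw [hT]
    exact Finset.mem_image_of_mem ψ (Finset.mem_univ b)
  obtain ⟨β₀, δ, α, β, γ, hℓ⟩ := LocalFormShape.eq_localForm_of_rowCol_invariant ℓ hdeg univ T hrow' hcol'
  refine ⟨C β₀ + C δ * (∑ a : Fin n, X (a, Sum.inr ())) +
    ((∑ a : Fin n, ∑ b : Fin c, C (α (a, ψ b)) * X (a, Sum.inl b)) +
      (∑ a : Fin n, C (β a) * X (a, Sum.inr ())) +
      (∑ b : Fin c, C (γ (ψ b)) * ∑ a : Fin n, X (a, Sum.inl b))), ?_⟩
  rw [hℓ]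
  have himg : ∀ (F : Fin n → MvPolynomial (Fin n × Fin n) ℂ), (∑ b ∈ T, F b) = ∑ b : Fin c, F (ψ b) := by
    intro F
    rw [hT, Finset.sum_image (fun x _ y _ h => hψ h)]
  simp only [map_add, map_mul, map_sum, algHom_C, algebraMap_eq, aeval_X, Sum.elim_inl, Sum.elim_inr, himg]

/-- From `vact` to an explicit renaming (rows). [folklore] -/
theorem vact_rowHom_eq_rename (σ : Perm (Fin n)) (q : MvPolynomial (Fin n × Fin n) ℂ) :
    vact (K := ℂ) rowHom σ q = rename (fun P : Fin n × Fin n => (σ P.1, P.2)) q := by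
  rw [vact_apply]
  have hf : (⇑(rowHom σ) : Fin n × Fin n → Fin n × Fin n) = fun P => (σ P.1, P.2) := funext (rowHom_apply σ)
  rw [hf]

/-- From `vact` to an explicit renaming (columns). [folklore] -/
theorem vact_colHom_eq_rename (τ : Perm (Fin n)) (q : MvPolynomial (Fin n × Fin n) ℂ) :
    vact (K := ℂ) colHom τ q = rename (fun P : Fin n × Fin n => (P.1, τ P.2)) q := by
  rw [vact_apply]
  have hf : (⇑(colHom τ) : Fin n × Fin n → Fin n × Fin n) = fun P => (P.1, τ P.2) := funext (colHom_apply τ)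
  rw [hf]

/-! ### The theorem -/

/-- **MATRIX-SYMMETRIC AFFINE PRODUCTS WITH COLUMN-UNTWISTED GROUPINGS ARE NARROW (supports form).**  Let
`C a · Π_i L_i ≠ 0` (degree-one factors) be invariant under every row/column renaming, with a column-support labelling
`S` (scalar-invariant, column-equivariant, row-invariant, `|S(L_i)| ≤ c₀`, `2c₀ < n`, `L_i` fixed by the column
renamings fixing `S(L_i)` pointwise).  If no column renaming rescales a column grouping `G_T = Π_{S(L_i) = T} L_i`
non-trivially, then `C a · Π_i L_i ∈ span_ℂ {hom_{F,n} : tw F ≤ 2c₀ + 1}`.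
[folklore; cite: DwivediPagoSeppelt2026, §8; Weyl1939, Chap. II §3; Macdonald1995, §I.2] -/
theorem prod_mem_narrowSpan_of_colUntwisted_matrixSymmetric_supports (c₀ : ℕ) (hc₀ : 2 * c₀ < n)
    {ι : Type} [Fintype ι] (L : ι → MvPolynomial (Fin n × Fin n) ℂ) (a : ℂ) (hL1 : ∀ i, (L i).totalDegree = 1)
    (hf0 : C a * ∏ i, L i ≠ 0)
    (hfix : ∀ σ τ : Perm (Fin n),
      rename (fun P : Fin n × Fin n => (σ P.1, τ P.2)) (C a * ∏ i, L i) = C a * ∏ i, L i)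
    (S : MvPolynomial (Fin n × Fin n) ℂ → Finset (Fin n))
    (S1 : ∀ (q : MvPolynomial (Fin n × Fin n) ℂ) (u : ℂ), u ≠ 0 → S (C u * q) = S q)
    (S2 : ∀ (q : MvPolynomial (Fin n × Fin n) ℂ) (τ : Perm (Fin n)), S (vact (K := ℂ) colHom τ q) = τ • S q)
    (S3 : ∀ (q : MvPolynomial (Fin n × Fin n) ℂ) (σ : Perm (Fin n)), S (vact (K := ℂ) rowHom σ q) = S q)
    (hSk : ∀ i, (S (L i)).card ≤ c₀)
    (hSfix : ∀ (i : ι) (ρ : Perm (Fin n)), (∀ x ∈ S (L i), ρ x = x) → vact (K := ℂ) colHom ρ (L i) = L i)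
    (Hcol : ∀ (τ : Perm (Fin n)) (T : Finset (Fin n)) (c : ℂ),
      rename (fun P : Fin n × Fin n => (P.1, τ P.2)) (∏ i ∈ (univ : Finset ι).filter (fun i => S (L i) = T), L i) =
        C c * ∏ i ∈ (univ : Finset ι).filter (fun i => S (L i) = T), L i → c = 1) :
    (C a * ∏ i, L i) ∈ Submodule.span ℂ {p : MvPolynomial (Fin n × Fin n) ℂ |
        ∃ (a b : ℕ) (E : Multiset (Fin a × Fin b)),
          treewidth (SimpleGraph.fromRel fun u v : Fin a ⊕ Fin b =>
            ∃ e ∈ E, u = Sum.inl e.1 ∧ v = Sum.inr e.2) ≤ 2 * c₀ + 1 ∧ p = homPoly E n ℂ} := by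
  classical
  have hL0 : ∀ i, L i ≠ 0 := by
    intro i h
    exact hf0 (by rw [Finset.prod_eq_zero (Finset.mem_univ i) h, mul_zero])
  have ha : a ≠ 0 := by
    rintro rfl
    exact hf0 (by rw [C_0, zero_mul])
  -- the column groupings, indexed by all finsets (empty groupings are `1`)
  set G : Finset (Fin n) → MvPolynomial (Fin n × Fin n) ℂ :=
    fun T => ∏ i ∈ (univ : Finset ι).filter (fun i => S (L i) = T), L i with hG
  have hG0 : ∀ T, G T ≠ 0 := fun T => Finset.prod_ne_zero_iff.2 fun i _ => hL0 i
  have hdecomp : (∏ i, L i) = ∏ T : Finset (Fin n), G T := by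
    rw [← Finset.prod_fiberwise_of_maps_to (s := (univ : Finset ι)) (t := (univ : Finset (Finset (Fin n))))
      (g := fun i => S (L i)) (fun i _ => Finset.mem_univ _) L]
  -- explicit renamings
  have hcolfix : ∀ (i : ι) (ρ : Perm (Fin n)), (∀ x ∈ S (L i), ρ x = x) →
      rename (fun P : Fin n × Fin n => (P.1, ρ P.2)) (L i) = L i := by
    intro i ρ hρ
    rw [← vact_colHom_eq_rename]
    exact hSfix i ρ hρ
  -- (loc) each grouping is a polynomial in the row atoms of its column core
  have hloc : ∀ T, ∃ (c : ℕ) (ψ : Fin c → Fin n) (P : MvPolynomial (Fin n × (Fin c ⊕ Unit)) ℂ), c ≤ c₀ ∧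
      G T = aeval (fun w : Fin n × (Fin c ⊕ Unit) =>
        Sum.elim (fun b : Fin c => (X (w.1, ψ b) : MvPolynomial (Fin n × Fin n) ℂ))
          (fun _ : Unit => ∑ j : Fin n, (X (w.1, j) : MvPolynomial (Fin n × Fin n) ℂ)) w.2) P := by
    intro T
    by_cases hT : T.card ≤ c₀
    · set ψ : Fin T.card → Fin n := fun b => T.orderEmbOfFin rfl b with hψ
      have hψinj : Function.Injective ψ := (T.orderEmbOfFin rfl).injective
      have hψmem : ∀ x ∈ T, ∃ b, ψ b = x := by
        intro x hx
        have : x ∈ Set.range (T.orderEmbOfFin rfl) := by rw [Finset.range_orderEmbOfFin]; exact hx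
        obtain ⟨b, hb⟩ := this
        exact ⟨b, hb⟩
      have hP : ∀ i ∈ (univ : Finset ι).filter (fun i => S (L i) = T),
          ∃ P : MvPolynomial (Fin n × (Fin T.card ⊕ Unit)) ℂ,
            L i = aeval (fun w : Fin n × (Fin T.card ⊕ Unit) =>
              Sum.elim (fun b : Fin T.card => (X (w.1, ψ b) : MvPolynomial (Fin n × Fin n) ℂ))
                (fun _ : Unit => ∑ j : Fin n, (X (w.1, j) : MvPolynomial (Fin n × Fin n) ℂ)) w.2) P := by
        intro i hi
        have hiT : S (L i) = T := (Finset.mem_filter.1 hi).2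
        refine exists_evalRowAtoms_of_colFixed T.card ψ hψinj (L i) (hL1 i).le fun ρ hρ => hcolfix i ρ ?_
        intro x hx
        rw [hiT] at hx
        obtain ⟨b, rfl⟩ := hψmem x hx
        exact hρ b
      choose P hP using hP
      refine ⟨T.card, ψ, ∏ i ∈ ((univ : Finset ι).filter (fun i => S (L i) = T)).attach, P i.1 i.2, hT, ?_⟩
      rw [map_prod]
      show (∏ i ∈ (univ : Finset ι).filter (fun i => S (L i) = T), L i) = _
      conv_lhs => rw [← Finset.prod_attach]
      exact Finset.prod_congr rfl fun i _ => hP i.1 i.2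
    · -- no factor has this label: the grouping is `1`
      have hempty : (univ : Finset ι).filter (fun i => S (L i) = T) = ∅ := by
        refine Finset.filter_eq_empty_iff.2 fun i _ hi => hT ?_
        rw [← hi]
        exact hSk i
      refine ⟨0, Fin.elim0, 1, Nat.zero_le _, ?_⟩
      rw [hG]
      simp only [hempty, Finset.prod_empty, map_one]
  -- (rows) every row renaming rescales every grouping
  have hrowG : ∀ (σ : Perm (Fin n)) (T : Finset (Fin n)), ∃ u : ℂ,
      rename (fun P : Fin n × Fin n => (σ P.1, P.2)) (G T) = C u * G T := by
    intro σ T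
    obtain ⟨c, -, hc⟩ := NormalisedFactors.exists_unit_labelBlock_rowCol L a hL1 hf0 σ 1 (hfix σ 1) S id
      Function.injective_id S1 (fun i => by
        rw [rename_prod_eq, S3, S2, one_smul]; rfl) T
    exact ⟨c, hc⟩
  -- (columns) every column renaming transports the groupings up to units along `T ↦ τ • T`
  have hcolG : ∀ τ : Perm (Fin n), ∃ κ : Perm (Finset (Fin n)), ∀ T, ∃ u : ℂ, u ≠ 0 ∧
      rename (fun P : Fin n × Fin n => (P.1, τ P.2)) (G T) = C u * G (κ T) := by
    intro τ
    refine ⟨MulAction.toPerm τ, fun T => ?_⟩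
    obtain ⟨c, hc0, hc⟩ := NormalisedFactors.exists_unit_labelBlock_rowCol L a hL1 hf0 1 τ (hfix 1 τ) S
      (fun T : Finset (Fin n) => τ • T) (fun T T' h => smul_left_cancel τ h) S1 (fun i => by
        rw [rename_prod_eq, S3, S2]) T
    exact ⟨c, hc0, hc⟩
  -- (invariance) the product of the groupings is row-invariant
  have hinvG : ∀ σ : Perm (Fin n), rename (fun P : Fin n × Fin n => (σ P.1, P.2)) (∏ T, G T) = ∏ T, G T := by
    intro σ
    have h := hfix σ 1
    rw [map_mul, rename_C, hdecomp] at h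
    have hCa : (C a : MvPolynomial (Fin n × Fin n) ℂ) ≠ 0 := by rwa [Ne, C_eq_zero]
    exact mul_left_cancel₀ hCa h
  have hmem := prod_mem_narrowSpan_of_colGrouped c₀ hc₀ G hG0 hloc hrowG hcolG
    (fun τ T c h => Hcol τ T c h) hinvG
  rw [hdecomp, ← smul_eq_C_mul]
  exact Submodule.smul_mem _ _ hmem

end SuperAtoms

end Summit.ValiantsHypothesis.ValiantsHypothesis.Theorems

end
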